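import Literature.NumberTheory.Sieve.HeathBrownCubicUpperBoundTools
import HarnessLib

/-!
# Ideal-weighted tools for the applications of Heath-Brown's Lemma 7.1 (§7, pp. 41–42)

Pure-proof companion of `HeathBrownCubicUpperBoundTools` (tenth layer of the decomposition of
**parity.S18** along D. R. Heath-Brown, *Primes represented by `x³ + 2y³`*, Acta Math. 186 (2001),
1–84). Heath-Brown's upper-bound sieve lemma, Lemma 7.1 (p. 39), is used in the paper — and proved
there — with the weight `∑ N(Q)^{-1}` over the IDEALS `Q` sieved (see (7.3)–(7.4), p. 42), not with
the printed `∑_{q∈𝒬} q^{-1}` over the set of norms (the two differ by the unbounded factor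
`#{Q : N(Q) = q} ≍ 3^{ω(q)}`; the literal display is withdrawn as mis-stated, see the module docstring of
`HeathBrownCubicUpperBound`). The dyadic-summation and piece lemmas of `HeathBrownCubicUpperBoundTools`
were written against the literal shape; this file re-proves them against the ideal-weighted shape
(hypothesis `h71`: for every finite set `𝒮` of ideals with square-free norms in `(N, 2N]`,
`0 < N ≤ X^{2−2τ}`, `∑_{Q∈𝒮} S(Q) ≤ C (M/log min(z, X^{2−τ}/N) · ∑_{Q∈𝒮} N(Q)^{-1} + Err)`), and adds
the elementary reciprocal-sum bookkeeping of p. 41 for the pieces `S₆`, `S₇`. Everything here is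
PROVED; no definition is introduced. The next file (`HeathBrownCubicUpperBoundProofs`) assembles these
into **Lemma 3.6 ⇐ Lemma 7.1 (ideal-weighted)**.

## Content (namespace `Literature.NumberTheory.Sieve.CubicSieve`)

* `dyadic_sum_ideal_le` — Lemma 7.1 (ideal-weighted) summed over the dyadic blocks of a range
  `[a, b)`, `b ≤ X^{2−2τ}`: main term `C (M/log min(z, X^{2−τ}/b)) ∑_{Q∈𝒮} N(Q)^{-1}`, error
  `(log b/log 2 + 1)·C·Err`.
* `primeRangeSum_boxPairs_ideal_le`, `primeRangeSum_normWindow_ideal_le` — the single-prime pieces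
  (`S₃`, `S₅`, p. 41) for `𝒜^(K)` (only first-degree `P` contribute, Lemma 3.1) and for `ℬ^(K)` (plus
  `≤ 3(√b + 1)` prime ideals of degree `≥ 2`, each with `#ℬ^(K)_P ≤ C_ℬX³/a`), with the weight
  `∑ N(P)^{-1}` over the first-degree primes of the range.
* `sum_good_ideal_le` — the good part (all `N(P_i)` prime and distinct) of a `U`-piece
  `∑_t S_K^≺(𝒵_{P_1⋯P_{n+1}}, P_{n+1})`, re-indexed injectively by the square-free-normed ideal
  `P_1⋯P_{n+1}` and bounded by Lemma 7.1 dyadically, weight `∑_t N(P_1⋯P_{n+1})^{-1}`.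
* `sum_inv_absNorm_uIdeal_one_le`, `sum_inv_absNorm_uIdeal_two_le` — `∑_t N(P_1⋯P_{n+1})^{-1}` for
  `n = 1, 2` dominated by sums over pairs / triples of primes covering the indices.
* `sum_pair_window_le` — the fibred double sum of p. 41,
  `∑_{p₂} ∑_{A/p₂ < p₁ ≤ B/p₂} (p₁p₂)^{-1} ≤ (∑ p₂^{-1}) · 3(log(B/A) + K₁)/log lmin` (Mertens windows of
  first-degree prime ideals, `HeathBrownCubicUpperBoundTools.sum_inv_absNorm_window_le`).
* `sum_pair_defect_le`, `sum_triple_defect_le` (with the factorisations `sum_triple_mul_eq`,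
  `sum_triple_pair12_eq`, `sum_triple_pair13_eq`, `sum_triple_pair23_eq`) — pairs / triples of prime
  ideals of norm `> Y` containing a prime of degree `≥ 2` or two primes of equal norm have reciprocal
  sum `≪ Y^{-1/3}(log x)²` ("prime ideals of degree greater than 1 may occur … these contribute
  `O(X^{3−1/12})`, say, which is negligible", p. 42; the equal-norm tuples are the tie terms of the
  order `≺` of `HeathBrownCubicSieveDecomposition`).

## References

* D. R. Heath-Brown, *Primes represented by `x³ + 2y³`*, Acta Math. 186 (2001), 1–84: Lemma 7.1
  (p. 39), §7 pp. 41–42 (the deduction of Lemma 3.6; (7.3)–(7.4)). [cite: HeathBrownActa2001, §7 pp. 41–42]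
* G. Harman, *Prime-Detecting Sieves*, LMS Monographs 33, Princeton (2007), §13.2. [cite: Harman2007, §13.2]

## Mathlib / tree search

Mathlib: `Finset.sum_image_le_of_nonneg`, `Finset.prod_pair`, `Finset.sum_product`,
`Finset.sum_mul_sum`, `Finset.sum_filter`, `Finset.sum_comm`, `Finset.sum_fiberwise_of_maps_to`
(no sieve over number fields; searched `Buchstab`, `sifted`). Tree: `HeathBrownCubicUpperBoundTools`
(`dyadIdx`, `normIn`, `famCount`, `uIdeal`, `UGood`, `uIdeal_injOn`, `squarefree_absNorm_uIdeal`,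
`countA_eq_zero_of_not_prime`, `sum_inv_absNorm_le`, `sum_inv_absNorm_nonprime_le`,
`sum_inv_absNorm_pair_eq_le`, `sum_inv_absNorm_window_le`, `card_filter_not_prime_absNorm_le`),
`HeathBrownCubicSieveDecomposition` (`famSifted`, `famSiftedAbove`, `primeRangeSum`, `Upairs`),
`HeathBrownCubicSieveSetup` (`siftedA`, `siftedB`, `primesNormIco`, `boxPairs`, `normWindow`).
-/

noncomputable section

open Polynomial NumberField Finset Filter Topology Asymptotics
open scoped nonZeroDivisors

namespace Literature.NumberTheory.Sieve.CubicSieve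

open LFunctions.CubeRootTwoField CubicPrimes

/-! ### Dyadic summation of the ideal-weighted Lemma 7.1 -/

/-- **Lemma 7.1 (ideal-weighted) summed dyadically.** If a function `S` of ideals satisfies the
conclusion of Lemma 7.1 in its ideal-weighted form on every dyadic block — for every finite set `𝒮`
of ideals with square-free norms in `(N, 2N]`, `0 < N ≤ X^{2−2τ}`,
`∑_{Q∈𝒮} S(Q) ≤ C (M/log min(z, X^{2−τ}/N) · ∑_{Q∈𝒮} N(Q)^{-1} + Err)` — then for every finite set
`𝒮` of ideals with square-free norms in `[a, b)`, `2 ≤ a ≤ b ≤ X^{2−2τ}`, `min(z, X^{2−τ}/b) > 1`,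
`∑_{Q∈𝒮} S(Q) ≤ C (M/log min(z, X^{2−τ}/b)) ∑_{Q∈𝒮} N(Q)^{-1} + (log b/log 2 + 1) C·Err`
(at most `log b/log 2 + 1` blocks meet `[a, b)`). This is how Lemma 7.1 is applied on pp. 41–42.
[cite: HeathBrownActa2001, §7 pp. 41–42] -/
theorem dyadic_sum_ideal_le {X τ z C M Err a b : ℝ} {S : Ideal (𝓞 K) → ℝ}
    (h71 : ∀ (N : ℝ) (𝒮 : Finset (Ideal (𝓞 K))), 0 < N → N ≤ X ^ (2 - 2 * τ) →
        (∀ Q ∈ 𝒮, Squarefree (Ideal.absNorm Q) ∧ N < (Ideal.absNorm Q : ℝ) ∧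
          (Ideal.absNorm Q : ℝ) ≤ 2 * N) →
        ∑ Q ∈ 𝒮, S Q ≤
          C * (M / Real.log (min z (X ^ (2 - τ) / N)) * ∑ Q ∈ 𝒮, ((Ideal.absNorm Q : ℕ) : ℝ)⁻¹ + Err))
    (hC : 0 ≤ C) (hM : 0 ≤ M) (hErr : 0 ≤ Err) (hX : 0 < X) (ha : 2 ≤ a) (hab : a ≤ b)
    (hb : b ≤ X ^ (2 - 2 * τ)) (hm : 1 < min z (X ^ (2 - τ) / b))
    (𝒮 : Finset (Ideal (𝓞 K)))
    (h𝒮 : ∀ Q ∈ 𝒮, Squarefree (Ideal.absNorm Q) ∧ a ≤ (Ideal.absNorm Q : ℝ) ∧ (Ideal.absNorm Q : ℝ) < b) :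
    ∑ Q ∈ 𝒮, S Q ≤
      C * (M / Real.log (min z (X ^ (2 - τ) / b)) * ∑ Q ∈ 𝒮, ((Ideal.absNorm Q : ℕ) : ℝ)⁻¹) +
        (Real.log b / Real.log 2 + 1) * (C * Err) := by
  classical
  set ℓ : ℝ := Real.log (min z (X ^ (2 - τ) / b)) with hℓ
  have hℓ0 : 0 < ℓ := Real.log_pos hm
  have hb2 : 2 ≤ b := ha.trans hab
  have hXp : 0 < X ^ (2 - τ) := Real.rpow_pos_of_pos hX _
  have hq2 : ∀ Q ∈ 𝒮, 2 ≤ Ideal.absNorm Q := fun Q hQ => by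
    have h := ha.trans (h𝒮 Q hQ).2.1
    exact_mod_cast h
  set J : Finset ℕ := 𝒮.image fun Q => dyadIdx (Ideal.absNorm Q) with hJ
  set blk : ℕ → Finset (Ideal (𝓞 K)) := fun j => 𝒮.filter fun Q => dyadIdx (Ideal.absNorm Q) = j
    with hblk
  -- each block estimate
  have hblock : ∀ j ∈ J, ∑ Q ∈ blk j, S Q ≤
      C * (M / ℓ * ∑ Q ∈ blk j, ((Ideal.absNorm Q : ℕ) : ℝ)⁻¹) + C * Err := by
    intro j hj
    obtain ⟨Q₀, hQ₀, hjQ₀⟩ := mem_image.mp hj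
    have hNpos : (0 : ℝ) < (2 : ℝ) ^ j := by positivity
    have hNb : (2 : ℝ) ^ j < b := by
      calc (2 : ℝ) ^ j = ((2 ^ dyadIdx (Ideal.absNorm Q₀) : ℕ) : ℝ) := by rw [← hjQ₀]; push_cast; ring
        _ < (Ideal.absNorm Q₀ : ℕ) := by exact_mod_cast pow_dyadIdx_lt (hq2 Q₀ hQ₀)
        _ < b := (h𝒮 Q₀ hQ₀).2.2
    have hNX : (2 : ℝ) ^ j ≤ X ^ (2 - 2 * τ) := hNb.le.trans hb
    have hmem : ∀ Q ∈ blk j, Squarefree (Ideal.absNorm Q) ∧ (2 : ℝ) ^ j < (Ideal.absNorm Q : ℝ) ∧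
        (Ideal.absNorm Q : ℝ) ≤ 2 * (2 : ℝ) ^ j := by
      intro Q hQ
      rw [hblk, mem_filter] at hQ
      obtain ⟨hQ𝒮, hQj⟩ := hQ
      refine ⟨(h𝒮 Q hQ𝒮).1, ?_, ?_⟩
      · calc (2 : ℝ) ^ j = ((2 ^ dyadIdx (Ideal.absNorm Q) : ℕ) : ℝ) := by rw [← hQj]; push_cast; ring
          _ < (Ideal.absNorm Q : ℕ) := by exact_mod_cast pow_dyadIdx_lt (hq2 Q hQ𝒮)
      · calc ((Ideal.absNorm Q : ℕ) : ℝ) ≤ ((2 ^ (dyadIdx (Ideal.absNorm Q) + 1) : ℕ) : ℝ) := by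
              exact_mod_cast le_pow_dyadIdx_succ _
          _ = 2 * (2 : ℝ) ^ j := by rw [← hQj]; push_cast; ring
    have h := h71 ((2 : ℝ) ^ j) (blk j) hNpos hNX hmem
    have hmin : min z (X ^ (2 - τ) / b) ≤ min z (X ^ (2 - τ) / (2 : ℝ) ^ j) :=
      min_le_min le_rfl (div_le_div_of_nonneg_left hXp.le hNpos hNb.le)
    have hlog : ℓ ≤ Real.log (min z (X ^ (2 - τ) / (2 : ℝ) ^ j)) :=
      Real.log_le_log (zero_lt_one.trans hm) hmin
    have hsum0 : 0 ≤ ∑ Q ∈ blk j, ((Ideal.absNorm Q : ℕ) : ℝ)⁻¹ := sum_nonneg fun Q _ => by positivity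
    calc ∑ Q ∈ blk j, S Q
        ≤ C * (M / Real.log (min z (X ^ (2 - τ) / (2 : ℝ) ^ j)) *
            ∑ Q ∈ blk j, ((Ideal.absNorm Q : ℕ) : ℝ)⁻¹ + Err) := h
      _ ≤ C * (M / ℓ * ∑ Q ∈ blk j, ((Ideal.absNorm Q : ℕ) : ℝ)⁻¹ + Err) := by
          have : M / Real.log (min z (X ^ (2 - τ) / (2 : ℝ) ^ j)) ≤ M / ℓ :=
            div_le_div_of_nonneg_left hM hℓ0 hlog
          gcongr
      _ = C * (M / ℓ * ∑ Q ∈ blk j, ((Ideal.absNorm Q : ℕ) : ℝ)⁻¹) + C * Err := by ring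
  -- sum the blocks
  have hLHS : ∑ Q ∈ 𝒮, S Q = ∑ j ∈ J, ∑ Q ∈ blk j, S Q := by
    rw [hblk]
    exact (sum_fiberwise_of_maps_to (g := fun Q => dyadIdx (Ideal.absNorm Q))
      (fun Q hQ => mem_image_of_mem (fun Q => dyadIdx (Ideal.absNorm Q)) hQ) _).symm
  have hrecip : ∑ j ∈ J, ∑ Q ∈ blk j, ((Ideal.absNorm Q : ℕ) : ℝ)⁻¹ =
      ∑ Q ∈ 𝒮, ((Ideal.absNorm Q : ℕ) : ℝ)⁻¹ := by
    rw [hblk]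
    exact sum_fiberwise_of_maps_to (g := fun Q => dyadIdx (Ideal.absNorm Q))
      (fun Q hQ => mem_image_of_mem (fun Q => dyadIdx (Ideal.absNorm Q)) hQ) _
  have hcardJ : (#J : ℝ) ≤ Real.log b / Real.log 2 + 1 := by
    have hsub : J ⊆ range (⌊Real.log b / Real.log 2⌋₊ + 1) := by
      intro j hj
      obtain ⟨Q₀, hQ₀, rfl⟩ := mem_image.mp hj
      rw [mem_range, Nat.lt_add_one_iff]
      exact Nat.le_floor (dyadIdx_le_log (hq2 Q₀ hQ₀) (h𝒮 Q₀ hQ₀).2.2)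
    have hlog0 : 0 ≤ Real.log b / Real.log 2 :=
      div_nonneg (Real.log_nonneg (by linarith)) (Real.log_nonneg one_le_two)
    calc (#J : ℝ) ≤ #(range (⌊Real.log b / Real.log 2⌋₊ + 1)) := by exact_mod_cast card_le_card hsub
      _ = (⌊Real.log b / Real.log 2⌋₊ : ℝ) + 1 := by rw [card_range]; push_cast; ring
      _ ≤ Real.log b / Real.log 2 + 1 := by linarith [Nat.floor_le hlog0]
  calc ∑ Q ∈ 𝒮, S Q = ∑ j ∈ J, ∑ Q ∈ blk j, S Q := hLHS
    _ ≤ ∑ j ∈ J, (C * (M / ℓ * ∑ Q ∈ blk j, ((Ideal.absNorm Q : ℕ) : ℝ)⁻¹) + C * Err) :=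
        sum_le_sum hblock
    _ = C * (M / ℓ * ∑ Q ∈ 𝒮, ((Ideal.absNorm Q : ℕ) : ℝ)⁻¹) + #J * (C * Err) := by
        rw [sum_add_distrib, sum_const, nsmul_eq_mul, ← hrecip, mul_sum, mul_sum]
    _ ≤ C * (M / ℓ * ∑ Q ∈ 𝒮, ((Ideal.absNorm Q : ℕ) : ℝ)⁻¹) +
          (Real.log b / Real.log 2 + 1) * (C * Err) := by
        gcongr

/-! ### The single-prime pieces `S₃`, `S₅` via the ideal-weighted Lemma 7.1 (p. 41) -/

/-- **The pieces `S₃(𝒜)`, `S₅(𝒜)` via Lemma 7.1 (ideal-weighted form)** (p. 41: "By Lemma 3.1, we may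
assume that `N(P)` is prime. Thus Lemma 7.1 yields
`S₃(𝒜) ≪ ∑_{X^{1−τ} ≤ p < X^{1+τ}} η²X²/(p log X) + X^{2−τ/5} …`"): for a range
`X^{1/2} ≤ a ≤ b ≤ X^{2−2τ}` with `min(X^{1/2}, X^{2−τ}/b) ≥ X^{1/4}`, lowering the sifting level to
`z = X^{1/2}` and summing Lemma 7.1 (hypothesis `h71A`, at level `z`, for sets of ideals) over dyadic
blocks of the prime ideals of prime norm in the range,
`∑_{a ≤ N(P) < b} S_K^≺(𝒜^(K)_P, P) ≤ C (η²X²/log X^{1/4}) ∑_{a ≤ N(P) < b, N(P) prime} N(P)^{-1}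
 + (log b/log 2 + 1) C X^{2−τ/5}`. [cite: HeathBrownActa2001, §7 p. 41] -/
theorem primeRangeSum_boxPairs_ideal_le {X η τ C a b : ℝ} (hX : 16 ≤ X) (hC : 0 ≤ C)
    (ha : X ^ (1 / 2 : ℝ) ≤ a) (hab : a ≤ b) (hb : b ≤ X ^ (2 - 2 * τ))
    (hm : X ^ (1 / 4 : ℝ) ≤ min (X ^ (1 / 2 : ℝ)) (X ^ (2 - τ) / b))
    (h71A : ∀ (N : ℝ) (𝒮 : Finset (Ideal (𝓞 K))), 0 < N → N ≤ X ^ (2 - 2 * τ) →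
        (∀ Q ∈ 𝒮, Squarefree (Ideal.absNorm Q) ∧ N < (Ideal.absNorm Q : ℝ) ∧
          (Ideal.absNorm Q : ℝ) ≤ 2 * N) →
        ∑ Q ∈ 𝒮, (siftedA X η Q (X ^ (1 / 2 : ℝ)) : ℝ) ≤
          C * (η ^ 2 * X ^ 2 / Real.log (min (X ^ (1 / 2 : ℝ)) (X ^ (2 - τ) / N)) *
            ∑ Q ∈ 𝒮, ((Ideal.absNorm Q : ℕ) : ℝ)⁻¹ + X ^ (2 - τ / 5))) :
    (primeRangeSum (boxPairs X η) pairIdeal a b : ℝ) ≤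
      C * (η ^ 2 * X ^ 2 / Real.log (X ^ (1 / 4 : ℝ))) *
          ∑ P ∈ (primesNormIco a b).filter (fun P => (Ideal.absNorm P).Prime),
            ((Ideal.absNorm P : ℕ) : ℝ)⁻¹ +
        (Real.log b / Real.log 2 + 1) * (C * X ^ (2 - τ / 5)) := by
  classical
  have hX0 : 0 < X := by linarith
  have hX1 : 1 < X := by linarith
  set z : ℝ := X ^ (1 / 2 : ℝ) with hz
  have hz4 : 4 ≤ z := by
    calc (4 : ℝ) = (16 : ℝ) ^ (1 / 2 : ℝ) := by
          rw [show (16 : ℝ) = 4 ^ (2 : ℝ) by norm_num, ← Real.rpow_mul (by norm_num)]; norm_num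
      _ ≤ X ^ (1 / 2 : ℝ) := Real.rpow_le_rpow (by norm_num) hX (by norm_num)
  have ha2 : 2 ≤ a := by linarith
  have hX14 : 1 < X ^ (1 / 4 : ℝ) := Real.one_lt_rpow hX1 (by norm_num)
  have hm1 : 1 < min (X ^ (1 / 2 : ℝ)) (X ^ (2 - τ) / b) := lt_of_lt_of_le hX14 hm
  set Pset := primesNormIco a b with hPset
  -- Step 1: lower the sifting level to `z ≤ a ≤ N(P)`
  have step1 : (primeRangeSum (boxPairs X η) pairIdeal a b : ℝ) ≤
      ∑ P ∈ Pset, (famSifted (boxPairs X η) pairIdeal P z : ℝ) := by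
    rw [primeRangeSum, Nat.cast_sum]
    refine sum_le_sum fun P hP => ?_
    have hNP : z ≤ Ideal.absNorm P := ha.trans ((mem_primesNormIco_iff.mp hP).2.2.1)
    exact_mod_cast famSiftedAbove_le_famSifted _ _ P P hNP
  -- Step 2: only `P` of prime norm contribute (Lemma 3.1)
  set good := Pset.filter fun P => (Ideal.absNorm P).Prime with hgood
  have step2 : ∑ P ∈ Pset, (famSifted (boxPairs X η) pairIdeal P z : ℝ) =
      ∑ P ∈ good, (siftedA X η P z : ℝ) := by
    rw [hgood, sum_filter_of_ne]
    · exact sum_congr rfl fun P _ => by rw [siftedA_eq_famSifted]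
    intro P hP hne
    by_contra hnp
    obtain ⟨hPp, hP0, -, -⟩ := mem_primesNormIco_iff.mp hP
    have h0 : famSifted (boxPairs X η) pairIdeal P z = 0 := by
      have h := famSifted_le_famCount (boxPairs X η) pairIdeal P z
      rw [famCount_boxPairs, countA_eq_zero_of_not_prime hPp hP0 dvd_rfl hnp] at h
      exact Nat.le_zero.mp h
    exact hne (by rw [siftedA_eq_famSifted, h0, Nat.cast_zero])
  -- Step 3: Lemma 7.1 over dyadic blocks of `good`
  have hgood' : ∀ Q ∈ good, Squarefree (Ideal.absNorm Q) ∧ a ≤ (Ideal.absNorm Q : ℝ) ∧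
      (Ideal.absNorm Q : ℝ) < b := by
    intro Q hQ
    rw [hgood, mem_filter, mem_primesNormIco_iff] at hQ
    obtain ⟨⟨-, -, haQ, hQb⟩, hprime⟩ := hQ
    exact ⟨hprime.squarefree, haQ, hQb⟩
  have hM0 : 0 ≤ η ^ 2 * X ^ 2 := by positivity
  have hErr0 : 0 ≤ X ^ (2 - τ / 5) := (Real.rpow_pos_of_pos hX0 _).le
  have step3 := dyadic_sum_ideal_le (S := fun Q => (siftedA X η Q z : ℝ)) h71A hC hM0 hErr0 hX0 ha2
    hab hb hm1 good hgood'
  -- Step 4: simplify the main term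
  have hlog4 : 0 < Real.log (X ^ (1 / 4 : ℝ)) := Real.log_pos hX14
  have hlogm : Real.log (X ^ (1 / 4 : ℝ)) ≤ Real.log (min (X ^ (1 / 2 : ℝ)) (X ^ (2 - τ) / b)) :=
    Real.log_le_log (by linarith) hm
  have hsum0 : 0 ≤ ∑ Q ∈ good, ((Ideal.absNorm Q : ℕ) : ℝ)⁻¹ := sum_nonneg fun Q _ => by positivity
  calc (primeRangeSum (boxPairs X η) pairIdeal a b : ℝ)
      ≤ ∑ P ∈ good, (siftedA X η P z : ℝ) := step1.trans step2.le
    _ ≤ C * (η ^ 2 * X ^ 2 / Real.log (min (X ^ (1 / 2 : ℝ)) (X ^ (2 - τ) / b)) *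
            ∑ Q ∈ good, ((Ideal.absNorm Q : ℕ) : ℝ)⁻¹) +
          (Real.log b / Real.log 2 + 1) * (C * X ^ (2 - τ / 5)) := step3
    _ ≤ C * (η ^ 2 * X ^ 2 / Real.log (X ^ (1 / 4 : ℝ)) *
            ∑ Q ∈ good, ((Ideal.absNorm Q : ℕ) : ℝ)⁻¹) +
          (Real.log b / Real.log 2 + 1) * (C * X ^ (2 - τ / 5)) := by
        have h1 : η ^ 2 * X ^ 2 / Real.log (min (X ^ (1 / 2 : ℝ)) (X ^ (2 - τ) / b)) ≤
            η ^ 2 * X ^ 2 / Real.log (X ^ (1 / 4 : ℝ)) :=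
          div_le_div_of_nonneg_left hM0 hlog4 hlogm
        gcongr
    _ = _ := by ring

/-- **The pieces `S₃(ℬ)`, `S₅(ℬ)` via Lemma 7.1 (ideal-weighted form)** (p. 41: "One may handle
`S₃(ℬ)` in much the same way. We no longer know that `N(P)` is prime. The contribution from prime
ideals `P` of degree `2`, however, is `≪ ∑ #ℬ^(K)_P ≪ ∑_{N(P) ≥ X^{1/2}} X³/N(P) ≪ X^{11/4}` … Inert
primes may be handled similarly"): as for `𝒜^(K)`, plus the prime ideals of non-prime norm in the
range, at most `3(√b + 1)` of them, each with `#ℬ^(K)_P ≤ C_ℬ X³/a`.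
[cite: HeathBrownActa2001, §7 p. 41] -/
theorem primeRangeSum_normWindow_ideal_le {X η τ C C_B a b : ℝ} (hX : 16 ≤ X) (hC : 0 ≤ C)
    (hCB : 0 ≤ C_B) (hη0 : 0 ≤ η)
    (ha : X ^ (1 / 2 : ℝ) ≤ a) (hab : a ≤ b) (hb : b ≤ X ^ (2 - 2 * τ))
    (hm : X ^ (1 / 4 : ℝ) ≤ min (X ^ (1 / 2 : ℝ)) (X ^ (2 - τ) / b))
    (h71B : ∀ (N : ℝ) (𝒮 : Finset (Ideal (𝓞 K))), 0 < N → N ≤ X ^ (2 - 2 * τ) →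
        (∀ Q ∈ 𝒮, Squarefree (Ideal.absNorm Q) ∧ N < (Ideal.absNorm Q : ℝ) ∧
          (Ideal.absNorm Q : ℝ) ≤ 2 * N) →
        ∑ Q ∈ 𝒮, (siftedB X η Q (X ^ (1 / 2 : ℝ)) : ℝ) ≤
          C * (η * X ^ 3 / Real.log (min (X ^ (1 / 2 : ℝ)) (X ^ (2 - τ) / N)) *
            ∑ Q ∈ 𝒮, ((Ideal.absNorm Q : ℕ) : ℝ)⁻¹ + X ^ (3 - τ / 5)))
    (hcountB : ∀ R : Ideal (𝓞 K), R ≠ ⊥ → (countB X η R : ℝ) ≤ C_B * X ^ 3 / Ideal.absNorm R) :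
    (primeRangeSum (normWindow X η) (fun J => J) a b : ℝ) ≤
      C * (η * X ^ 3 / Real.log (X ^ (1 / 4 : ℝ))) *
          ∑ P ∈ (primesNormIco a b).filter (fun P => (Ideal.absNorm P).Prime),
            ((Ideal.absNorm P : ℕ) : ℝ)⁻¹ +
        (Real.log b / Real.log 2 + 1) * (C * X ^ (3 - τ / 5)) +
        3 * (Real.sqrt b + 1) * (C_B * X ^ 3 / a) := by
  classical
  have hX0 : 0 < X := by linarith
  have hX1 : 1 < X := by linarith
  set z : ℝ := X ^ (1 / 2 : ℝ) with hz
  have hz4 : 4 ≤ z := by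
    calc (4 : ℝ) = (16 : ℝ) ^ (1 / 2 : ℝ) := by
          rw [show (16 : ℝ) = 4 ^ (2 : ℝ) by norm_num, ← Real.rpow_mul (by norm_num)]; norm_num
      _ ≤ X ^ (1 / 2 : ℝ) := Real.rpow_le_rpow (by norm_num) hX (by norm_num)
  have ha2 : 2 ≤ a := by linarith
  have ha0 : 0 < a := by linarith
  have hX14 : 1 < X ^ (1 / 4 : ℝ) := Real.one_lt_rpow hX1 (by norm_num)
  have hm1 : 1 < min (X ^ (1 / 2 : ℝ)) (X ^ (2 - τ) / b) := lt_of_lt_of_le hX14 hm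
  set Pset := primesNormIco a b with hPset
  set E := normWindow X η with hE
  -- Step 1: lower the sifting level to `z ≤ a ≤ N(P)`
  have step1 : (primeRangeSum E (fun J => J) a b : ℝ) ≤
      ∑ P ∈ Pset, (famSifted E (fun J => J) P z : ℝ) := by
    rw [primeRangeSum, Nat.cast_sum]
    refine sum_le_sum fun P hP => ?_
    have hNP : z ≤ Ideal.absNorm P := ha.trans ((mem_primesNormIco_iff.mp hP).2.2.1)
    exact_mod_cast famSiftedAbove_le_famSifted _ _ P P hNP
  -- Step 2: split into prime norm (good) and the rest (bad)
  set good := Pset.filter fun P => (Ideal.absNorm P).Prime with hgood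
  set bad := Pset.filter fun P => ¬ (Ideal.absNorm P).Prime with hbad
  have step2 : ∑ P ∈ Pset, (famSifted E (fun J => J) P z : ℝ) =
      ∑ P ∈ good, (siftedB X η P z : ℝ) + ∑ P ∈ bad, (famSifted E (fun J => J) P z : ℝ) := by
    rw [hgood, hbad, ← sum_filter_add_sum_filter_not Pset (fun P => (Ideal.absNorm P).Prime)]
    congr 1
    exact sum_congr rfl fun P _ => by rw [hE, siftedB_eq_famSifted]
  -- Step 3 (bad): at most `3(√b+1)` primes of non-prime norm below `b`, each with `#ℬ_P ≤ C_B X³/a`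
  have hbad_card : (#bad : ℝ) ≤ 3 * (Real.sqrt b + 1) := by
    have hsub : bad ⊆ (Literature.NumberTheory.LFunctions.NumberField.finite_primeIdealsLE K b).toFinset.filter
        fun P => ¬ (Ideal.absNorm P).Prime := by
      intro P hP
      rw [hbad, mem_filter, mem_primesNormIco_iff] at hP
      obtain ⟨⟨hPp, hP0, -, hPb⟩, hnp⟩ := hP
      simp only [mem_filter, Set.Finite.mem_toFinset,
        Literature.NumberTheory.LFunctions.NumberField.primeIdealsLE, Set.mem_setOf_eq]
      exact ⟨⟨hPp, hP0, hPb.le⟩, hnp⟩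
    calc (#bad : ℝ) ≤ #((Literature.NumberTheory.LFunctions.NumberField.finite_primeIdealsLE K b).toFinset.filter
          fun P => ¬ (Ideal.absNorm P).Prime) := by exact_mod_cast card_le_card hsub
      _ ≤ Module.finrank ℚ K * (Real.sqrt b + 1) := card_filter_not_prime_absNorm_le _
      _ = 3 * (Real.sqrt b + 1) := by rw [finrank_K]; norm_num
  have step3bad : ∑ P ∈ bad, (famSifted E (fun J => J) P z : ℝ) ≤
      3 * (Real.sqrt b + 1) * (C_B * X ^ 3 / a) := by
    have hterm : ∀ P ∈ bad, (famSifted E (fun J => J) P z : ℝ) ≤ C_B * X ^ 3 / a := by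
      intro P hP
      rw [hbad, mem_filter, mem_primesNormIco_iff] at hP
      obtain ⟨⟨hPp, hP0, haP, -⟩, -⟩ := hP
      have hNP : 0 < (Ideal.absNorm P : ℝ) := lt_of_lt_of_le ha0 haP
      calc (famSifted E (fun J => J) P z : ℝ) ≤ famCount E (fun J => J) P := by
            exact_mod_cast famSifted_le_famCount E _ P z
        _ = countB X η P := by rw [hE, famCount_normWindow]
        _ ≤ C_B * X ^ 3 / Ideal.absNorm P := hcountB P hP0
        _ ≤ C_B * X ^ 3 / a := div_le_div_of_nonneg_left (by positivity) ha0 haP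
    calc ∑ P ∈ bad, (famSifted E (fun J => J) P z : ℝ) ≤ ∑ P ∈ bad, C_B * X ^ 3 / a :=
          sum_le_sum hterm
      _ = #bad * (C_B * X ^ 3 / a) := by rw [sum_const, nsmul_eq_mul]
      _ ≤ 3 * (Real.sqrt b + 1) * (C_B * X ^ 3 / a) :=
          mul_le_mul_of_nonneg_right hbad_card (by positivity)
  -- Step 3 (good): Lemma 7.1 over dyadic blocks
  have hgood' : ∀ Q ∈ good, Squarefree (Ideal.absNorm Q) ∧ a ≤ (Ideal.absNorm Q : ℝ) ∧
      (Ideal.absNorm Q : ℝ) < b := by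
    intro Q hQ
    rw [hgood, mem_filter, mem_primesNormIco_iff] at hQ
    obtain ⟨⟨-, -, haQ, hQb⟩, hprime⟩ := hQ
    exact ⟨hprime.squarefree, haQ, hQb⟩
  have hM0 : 0 ≤ η * X ^ 3 := by positivity
  have hErr0 : 0 ≤ X ^ (3 - τ / 5) := (Real.rpow_pos_of_pos hX0 _).le
  have step3 := dyadic_sum_ideal_le (S := fun Q => (siftedB X η Q z : ℝ)) h71B hC hM0 hErr0 hX0 ha2
    hab hb hm1 good hgood'
  -- Step 4: simplify the main term
  have hlog4 : 0 < Real.log (X ^ (1 / 4 : ℝ)) := Real.log_pos hX14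
  have hlogm : Real.log (X ^ (1 / 4 : ℝ)) ≤ Real.log (min (X ^ (1 / 2 : ℝ)) (X ^ (2 - τ) / b)) :=
    Real.log_le_log (by linarith) hm
  have hsum0 : 0 ≤ ∑ Q ∈ good, ((Ideal.absNorm Q : ℕ) : ℝ)⁻¹ := sum_nonneg fun Q _ => by positivity
  have hmain : ∑ P ∈ good, (siftedB X η P z : ℝ) ≤
      C * (η * X ^ 3 / Real.log (X ^ (1 / 4 : ℝ))) * ∑ Q ∈ good, ((Ideal.absNorm Q : ℕ) : ℝ)⁻¹ +
        (Real.log b / Real.log 2 + 1) * (C * X ^ (3 - τ / 5)) := by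
    calc ∑ P ∈ good, (siftedB X η P z : ℝ)
        ≤ C * (η * X ^ 3 / Real.log (min (X ^ (1 / 2 : ℝ)) (X ^ (2 - τ) / b)) *
            ∑ Q ∈ good, ((Ideal.absNorm Q : ℕ) : ℝ)⁻¹) +
            (Real.log b / Real.log 2 + 1) * (C * X ^ (3 - τ / 5)) := step3
      _ ≤ C * (η * X ^ 3 / Real.log (X ^ (1 / 4 : ℝ)) * ∑ Q ∈ good, ((Ideal.absNorm Q : ℕ) : ℝ)⁻¹) +
            (Real.log b / Real.log 2 + 1) * (C * X ^ (3 - τ / 5)) := by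
          have h1 : η * X ^ 3 / Real.log (min (X ^ (1 / 2 : ℝ)) (X ^ (2 - τ) / b)) ≤
              η * X ^ 3 / Real.log (X ^ (1 / 4 : ℝ)) :=
            div_le_div_of_nonneg_left hM0 hlog4 hlogm
          gcongr
      _ = _ := by ring
  calc (primeRangeSum E (fun J => J) a b : ℝ)
      ≤ ∑ P ∈ good, (siftedB X η P z : ℝ) + ∑ P ∈ bad, (famSifted E (fun J => J) P z : ℝ) :=
        step1.trans step2.le
    _ ≤ (C * (η * X ^ 3 / Real.log (X ^ (1 / 4 : ℝ))) * ∑ Q ∈ good, ((Ideal.absNorm Q : ℕ) : ℝ)⁻¹ +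
          (Real.log b / Real.log 2 + 1) * (C * X ^ (3 - τ / 5))) +
          3 * (Real.sqrt b + 1) * (C_B * X ^ 3 / a) := add_le_add hmain step3bad

open scoped Classical in
/-- **The good part of a `U`-piece via Lemma 7.1 (ideal-weighted form).** For a family `(E, I)`, a
function `S` with `S_K(𝒵_R, z) ≤ S(R)` satisfying the ideal-weighted conclusion of Lemma 7.1 on
dyadic blocks, and a set `T` of indices of `U^(n)` with `z ≤ N(P_{n+1})` whose good members have
`a ≤ N(P_1⋯P_{n+1}) < b`: the good part of `∑_{t ∈ T} S_K^≺(𝒵_{P_1⋯P_{n+1}}, P_{n+1})` is at most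
`C (M/log min(z, X^{2−τ}/b)) ∑_{t good} 1/N(P_1⋯P_{n+1}) + (log b/log 2 + 1) C·Err` (lower the level
to `z`, re-index injectively by the ideal `P_1⋯P_{n+1}`, whose norm is square-free, and sum Lemma 7.1
dyadically over these ideals). This is the common shape of the treatment of `S₆`, `S₇` on p. 41 and of
(7.3)–(7.4) on p. 42. [cite: HeathBrownActa2001, §7 pp. 41–42] -/
theorem sum_good_ideal_le {ι : Type*} (E : Finset ι) (I : ι → Ideal (𝓞 K)) {X τ z C M Err a b : ℝ}
    {n : ℕ} {S : Ideal (𝓞 K) → ℝ} (hS : ∀ R, (famSifted E I R z : ℝ) ≤ S R)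
    (h71 : ∀ (N : ℝ) (𝒮 : Finset (Ideal (𝓞 K))), 0 < N → N ≤ X ^ (2 - 2 * τ) →
        (∀ Q ∈ 𝒮, Squarefree (Ideal.absNorm Q) ∧ N < (Ideal.absNorm Q : ℝ) ∧
          (Ideal.absNorm Q : ℝ) ≤ 2 * N) →
        ∑ Q ∈ 𝒮, S Q ≤
          C * (M / Real.log (min z (X ^ (2 - τ) / N)) * ∑ Q ∈ 𝒮, ((Ideal.absNorm Q : ℕ) : ℝ)⁻¹ + Err))
    (hC : 0 ≤ C) (hM : 0 ≤ M) (hErr : 0 ≤ Err) (hX : 0 < X) (ha : 2 ≤ a) (hab : a ≤ b)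
    (hb : b ≤ X ^ (2 - 2 * τ)) (hm : 1 < min z (X ^ (2 - τ) / b))
    (T : Finset (Finset (Ideal (𝓞 K)) × Ideal (𝓞 K))) (hT : T ⊆ Upairs X τ n)
    (hz : ∀ t ∈ T, z ≤ Ideal.absNorm t.2)
    (hrange : ∀ t ∈ T, UGood t →
      a ≤ (Ideal.absNorm (uIdeal t) : ℝ) ∧ (Ideal.absNorm (uIdeal t) : ℝ) < b) :
    ∑ t ∈ T.filter UGood, (famSiftedAbove E I (uIdeal t) t.2 : ℝ) ≤
      C * (M / Real.log (min z (X ^ (2 - τ) / b)) *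
          ∑ t ∈ T.filter UGood, ((Ideal.absNorm (uIdeal t) : ℕ) : ℝ)⁻¹) +
        (Real.log b / Real.log 2 + 1) * (C * Err) := by
  classical
  set Tg := T.filter UGood with hTg
  have hTgU : ∀ t ∈ Tg, t ∈ Upairs X τ n := fun t ht => hT (mem_filter.mp ht).1
  -- Step 1: lower the level and pass to `S`
  have step1 : ∑ t ∈ Tg, (famSiftedAbove E I (uIdeal t) t.2 : ℝ) ≤ ∑ t ∈ Tg, S (uIdeal t) := by
    refine sum_le_sum fun t ht => ?_
    have ht' := (mem_filter.mp ht).1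
    calc (famSiftedAbove E I (uIdeal t) t.2 : ℝ) ≤ famSifted E I (uIdeal t) z := by
          exact_mod_cast famSiftedAbove_le_famSifted E I _ _ (hz t ht')
      _ ≤ S (uIdeal t) := hS _
  -- Step 2: re-index by the ideal (injective)
  set 𝒮 := Tg.image uIdeal with h𝒮def
  have hinj : Set.InjOn uIdeal (Tg : Set _) := (uIdeal_injOn X τ n).mono fun t ht => hTgU t ht
  have step2 : ∑ t ∈ Tg, S (uIdeal t) = ∑ Q ∈ 𝒮, S Q := by
    rw [h𝒮def, sum_image (g := uIdeal) (f := S) hinj]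
  have hrecip : ∑ Q ∈ 𝒮, ((Ideal.absNorm Q : ℕ) : ℝ)⁻¹ =
      ∑ t ∈ Tg, ((Ideal.absNorm (uIdeal t) : ℕ) : ℝ)⁻¹ := by
    rw [h𝒮def, sum_image (g := uIdeal) (f := fun Q => ((Ideal.absNorm Q : ℕ) : ℝ)⁻¹) hinj]
  -- Step 3: Lemma 7.1 dyadically
  have h𝒮 : ∀ Q ∈ 𝒮, Squarefree (Ideal.absNorm Q) ∧ a ≤ (Ideal.absNorm Q : ℝ) ∧
      (Ideal.absNorm Q : ℝ) < b := by
    intro Q hQ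
    obtain ⟨t, ht, rfl⟩ := mem_image.mp hQ
    obtain ⟨htT, hg⟩ := mem_filter.mp ht
    exact ⟨squarefree_absNorm_uIdeal (snd_notMem_fst (hT htT)) hg, hrange t htT hg⟩
  have step3 := dyadic_sum_ideal_le h71 hC hM hErr hX ha hab hb hm 𝒮 h𝒮
  rw [hrecip] at step3
  calc ∑ t ∈ Tg, (famSiftedAbove E I (uIdeal t) t.2 : ℝ) ≤ ∑ Q ∈ 𝒮, S Q := step1.trans step2.le
    _ ≤ _ := step3

/-! ### Re-indexing the `U`-pieces with `n = 1, 2` by tuples of primes (p. 41) -/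

/-- **Indices of `U^(1)` as pairs of primes.** If every index `t = ({P_1}, P_2)` in `T` has
`(P_1, P_2) ∈ D`, then `∑_{t∈T} N(P_1P_2)^{-1} ≤ ∑_{(P_1,P_2)∈D} N(P_1)^{-1}N(P_2)^{-1}` (the map
`(P_1, P_2) ↦ ({P_1}, P_2)` covers `T`). This is the passage from `S₆` to the double sum
`∑ (p_1p_2)^{-1}` on p. 41. [cite: HeathBrownActa2001, §7 p. 41] -/
theorem sum_inv_absNorm_uIdeal_one_le (T : Finset (Finset (Ideal (𝓞 K)) × Ideal (𝓞 K)))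
    (D : Finset (Ideal (𝓞 K) × Ideal (𝓞 K)))
    (hcover : ∀ t ∈ T, ∃ P₁, t.1 = {P₁} ∧ (P₁, t.2) ∈ D) :
    ∑ t ∈ T, ((Ideal.absNorm (uIdeal t) : ℕ) : ℝ)⁻¹ ≤
      ∑ x ∈ D, ((Ideal.absNorm x.1 : ℕ) : ℝ)⁻¹ * ((Ideal.absNorm x.2 : ℕ) : ℝ)⁻¹ := by
  classical
  set φ : Ideal (𝓞 K) × Ideal (𝓞 K) → Finset (Ideal (𝓞 K)) × Ideal (𝓞 K) :=
    fun x => ({x.1}, x.2) with hφ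
  have hsub : T ⊆ D.image φ := by
    intro t ht
    obtain ⟨P₁, h1, hD⟩ := hcover t ht
    refine mem_image.mpr ⟨(P₁, t.2), hD, ?_⟩
    rw [hφ]
    ext <;> simp [h1]
  calc ∑ t ∈ T, ((Ideal.absNorm (uIdeal t) : ℕ) : ℝ)⁻¹
      ≤ ∑ t ∈ D.image φ, ((Ideal.absNorm (uIdeal t) : ℕ) : ℝ)⁻¹ :=
        sum_le_sum_of_subset_of_nonneg hsub fun _ _ _ => by positivity
    _ ≤ ∑ x ∈ D, ((Ideal.absNorm (uIdeal (φ x)) : ℕ) : ℝ)⁻¹ :=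
        sum_image_le_of_nonneg fun _ _ => by positivity
    _ = _ := sum_congr rfl fun x _ => by
        rw [hφ]
        simp only [uIdeal, prod_singleton, map_mul, Nat.cast_mul, mul_inv]

/-- **Indices of `U^(2)` as triples of primes.** If every index `t = ({P_1, P_2}, P_3)` in `T`
(`P_1 ≠ P_2`) has `(P_1, P_2, P_3) ∈ D`, a set of triples with distinct first two entries, then
`∑_{t∈T} N(P_1P_2P_3)^{-1} ≤ ∑_{(P_1,P_2,P_3)∈D} N(P_1)^{-1}N(P_2)^{-1}N(P_3)^{-1}`. This is the passage
from `S₇` to the triple sum `∑ (p_1p_2p_3)^{-1}` on p. 41. [cite: HeathBrownActa2001, §7 p. 41] -/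
theorem sum_inv_absNorm_uIdeal_two_le (T : Finset (Finset (Ideal (𝓞 K)) × Ideal (𝓞 K)))
    (D : Finset (Ideal (𝓞 K) × Ideal (𝓞 K) × Ideal (𝓞 K))) (hD : ∀ x ∈ D, x.1 ≠ x.2.1)
    (hcover : ∀ t ∈ T, ∃ P₁ P₂, P₁ ≠ P₂ ∧ t.1 = {P₁, P₂} ∧ (P₁, P₂, t.2) ∈ D) :
    ∑ t ∈ T, ((Ideal.absNorm (uIdeal t) : ℕ) : ℝ)⁻¹ ≤
      ∑ x ∈ D, ((Ideal.absNorm x.1 : ℕ) : ℝ)⁻¹ * ((Ideal.absNorm x.2.1 : ℕ) : ℝ)⁻¹ *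
        ((Ideal.absNorm x.2.2 : ℕ) : ℝ)⁻¹ := by
  classical
  set φ : Ideal (𝓞 K) × Ideal (𝓞 K) × Ideal (𝓞 K) → Finset (Ideal (𝓞 K)) × Ideal (𝓞 K) :=
    fun x => ({x.1, x.2.1}, x.2.2) with hφ
  have hsub : T ⊆ D.image φ := by
    intro t ht
    obtain ⟨P₁, P₂, -, h1, hD'⟩ := hcover t ht
    refine mem_image.mpr ⟨(P₁, P₂, t.2), hD', ?_⟩
    rw [hφ]
    ext <;> simp [h1]
  calc ∑ t ∈ T, ((Ideal.absNorm (uIdeal t) : ℕ) : ℝ)⁻¹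
      ≤ ∑ t ∈ D.image φ, ((Ideal.absNorm (uIdeal t) : ℕ) : ℝ)⁻¹ :=
        sum_le_sum_of_subset_of_nonneg hsub fun _ _ _ => by positivity
    _ ≤ ∑ x ∈ D, ((Ideal.absNorm (uIdeal (φ x)) : ℕ) : ℝ)⁻¹ :=
        sum_image_le_of_nonneg fun _ _ => by positivity
    _ = _ := sum_congr rfl fun x hx => by
        rw [hφ]
        simp only [uIdeal, prod_pair (hD x hx), map_mul, Nat.cast_mul, mul_inv]

/-- **The fibred double sum of p. 41**: "`∑_{X^τ≤p₂<p₁<X^{1−τ}, X^{3/2−τ}<p₁p₂<X^{3/2+τ}} (p₁p₂)^{-1}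
≤ ∑_{p₂} ∑_{X^{3/2−τ}/p₂ < p₁ < X^{3/2+τ}/p₂} (p₁p₂)^{-1} ≪ ∑_{p₂} p₂^{-1}·τ`", abstractly: for sets
`W₂` (any ideals of positive norm with `lmin·N(P₂) ≤ A`) and `W₁` (nonzero prime ideals of prime
norm), `∑_{(P₂,P₁), A < N(P₂)N(P₁) ≤ B} N(P₂)^{-1}N(P₁)^{-1} ≤ (∑_{W₂} N(P₂)^{-1}) · 3(log(B/A) + K₁)/log lmin`,
the inner sums being windows `(A/N(P₂), B/N(P₂)]` of first-degree primes (Mertens, hypothesis `hK`).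
[cite: HeathBrownActa2001, §7 p. 41] -/
theorem sum_pair_window_le {K₁ : ℝ}
    (hK : ∀ (lo hi : ℝ) (T : Finset ℕ), 2 ≤ lo → lo ≤ hi →
      (∀ p ∈ T, p.Prime ∧ lo < (p : ℝ) ∧ (p : ℝ) ≤ hi) →
      ∑ p ∈ T, (p : ℝ)⁻¹ ≤ (Real.log (hi / lo) + K₁) / Real.log lo)
    (hK0 : 0 ≤ K₁) (W₂ W₁ : Finset (Ideal (𝓞 K)))
    (hW₁ : ∀ P ∈ W₁, P.IsPrime ∧ P ≠ ⊥ ∧ (Ideal.absNorm P).Prime)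
    {A B lmin : ℝ} (hl : 2 ≤ lmin) (hAB : A ≤ B)
    (hW₂ : ∀ P ∈ W₂, 0 < (Ideal.absNorm P : ℝ) ∧ lmin * (Ideal.absNorm P : ℝ) ≤ A) :
    ∑ x ∈ (W₂ ×ˢ W₁).filter (fun x => A < (Ideal.absNorm x.1 : ℝ) * Ideal.absNorm x.2 ∧
        (Ideal.absNorm x.1 : ℝ) * Ideal.absNorm x.2 ≤ B),
        ((Ideal.absNorm x.1 : ℕ) : ℝ)⁻¹ * ((Ideal.absNorm x.2 : ℕ) : ℝ)⁻¹ ≤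
      (∑ P ∈ W₂, ((Ideal.absNorm P : ℕ) : ℝ)⁻¹) * (3 * ((Real.log (B / A) + K₁) / Real.log lmin)) := by
  classical
  have hl1 : 1 < lmin := by linarith
  have hllmin : 0 < Real.log lmin := Real.log_pos hl1
  rw [sum_filter, sum_product, sum_mul]
  refine sum_le_sum fun P₂ hP₂ => ?_
  obtain ⟨hN₂, hlA⟩ := hW₂ P₂ hP₂
  have hA0 : 0 < A := lt_of_lt_of_le (by positivity) hlA
  have hBA : 0 ≤ Real.log (B / A) := Real.log_nonneg ((one_le_div hA0).mpr hAB)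
  set lo : ℝ := A / Ideal.absNorm P₂ with hlo
  set hi : ℝ := B / Ideal.absNorm P₂ with hhi
  have hlo2 : lmin ≤ lo := by rw [hlo, le_div_iff₀ hN₂]; exact hlA
  have hlohi : lo ≤ hi := div_le_div_of_nonneg_right hAB hN₂.le
  set W₁' := W₁.filter fun P₁ => A < (Ideal.absNorm P₂ : ℝ) * Ideal.absNorm P₁ ∧
      (Ideal.absNorm P₂ : ℝ) * Ideal.absNorm P₁ ≤ B with hW₁'
  have hinner := sum_inv_absNorm_window_le hK (hl.trans hlo2) hlohi W₁' (fun P₁ hP₁ => by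
      rw [hW₁', mem_filter] at hP₁
      obtain ⟨hW, h1, h2⟩ := hP₁
      refine ⟨(hW₁ P₁ hW).1, (hW₁ P₁ hW).2.1, (hW₁ P₁ hW).2.2, ?_, ?_⟩
      · rw [hlo, div_lt_iff₀ hN₂]; linarith
      · rw [hhi, le_div_iff₀ hN₂]; linarith)
  have hratio : hi / lo = B / A := by
    rw [hhi, hlo, div_div_div_cancel_right₀ hN₂.ne']
  rw [hratio] at hinner
  have hlog : (Real.log (B / A) + K₁) / Real.log lo ≤ (Real.log (B / A) + K₁) / Real.log lmin :=
    div_le_div_of_nonneg_left (by positivity) hllmin (Real.log_le_log (by linarith) hlo2)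
  have hsum : ∑ P₁ ∈ W₁, (if A < (Ideal.absNorm P₂ : ℝ) * Ideal.absNorm P₁ ∧
        (Ideal.absNorm P₂ : ℝ) * Ideal.absNorm P₁ ≤ B then
      ((Ideal.absNorm P₂ : ℕ) : ℝ)⁻¹ * ((Ideal.absNorm P₁ : ℕ) : ℝ)⁻¹ else 0) =
      ((Ideal.absNorm P₂ : ℕ) : ℝ)⁻¹ * ∑ P₁ ∈ W₁', ((Ideal.absNorm P₁ : ℕ) : ℝ)⁻¹ := by
    rw [hW₁', sum_filter, mul_sum]
    refine sum_congr rfl fun P₁ _ => ?_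
    split_ifs <;> simp
  rw [hsum]
  refine mul_le_mul_of_nonneg_left (hinner.trans ?_) (by positivity)
  linarith

/-! ### Index tuples with a prime of degree `≥ 2` or two primes of equal norm (p. 42) -/

/-- **Defective pairs are negligible**: over pairs `(P, P')` of nonzero prime ideals with norms in
`(Y, x]` such that `N(P)` or `N(P')` is not prime, or `N(P) = N(P')`,
`∑ N(P)^{-1}N(P')^{-1} ≤ 2·(6Y^{-1/3})·3(1 + log x) + 18/Y` ("prime ideals of degree greater than
`1` may occur … these contribute `O(X^{3−1/12})`, say, which is negligible", p. 42; the equal-norm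
pairs are the tie terms of the ordering `≺`). [cite: HeathBrownActa2001, §7 p. 42] -/
theorem sum_pair_defect_le {Y x : ℝ} (hY : 8 ≤ Y) (hx : 1 ≤ x) (V : Finset (Ideal (𝓞 K)))
    (hV : ∀ P ∈ V, P.IsPrime ∧ P ≠ ⊥ ∧ Y < (Ideal.absNorm P : ℝ) ∧ (Ideal.absNorm P : ℝ) ≤ x) :
    ∑ p ∈ (V ×ˢ V).filter (fun p => ¬ (Ideal.absNorm p.1).Prime ∨ ¬ (Ideal.absNorm p.2).Prime ∨
        Ideal.absNorm p.1 = Ideal.absNorm p.2),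
        ((Ideal.absNorm p.1 : ℕ) : ℝ)⁻¹ * ((Ideal.absNorm p.2 : ℕ) : ℝ)⁻¹ ≤
      2 * (6 / Y ^ (1 / 3 : ℝ)) * (3 * (1 + Real.log x)) + 18 / Y := by
  classical
  set f : Ideal (𝓞 K) → ℝ := fun P => ((Ideal.absNorm P : ℕ) : ℝ)⁻¹ with hf
  have hf0 : ∀ P, 0 ≤ f P := fun P => by rw [hf]; positivity
  -- indicators of the two kinds of defect
  set d : Ideal (𝓞 K) → ℝ := fun P => if ¬ (Ideal.absNorm P).Prime then f P else 0 with hd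
  set e : Ideal (𝓞 K) → Ideal (𝓞 K) → ℝ :=
    fun P P' => if Ideal.absNorm P = Ideal.absNorm P' then f P * f P' else 0 with he
  have hd0 : ∀ P, 0 ≤ d P := fun P => by
    rw [hd]; dsimp only; split_ifs <;> first | exact le_rfl | exact hf0 P
  have he0 : ∀ P P', 0 ≤ e P P' := fun P P' => by
    rw [he]; dsimp only; split_ifs <;> first | exact le_rfl | exact mul_nonneg (hf0 P) (hf0 P')
  -- the basic sums
  set S := ∑ P ∈ V, f P with hS
  have hS0 : 0 ≤ S := sum_nonneg fun P _ => hf0 P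
  have hSH : S ≤ 3 * (1 + Real.log x) :=
    sum_inv_absNorm_le hx V fun P hP => ⟨(hV P hP).1, (hV P hP).2.1, (hV P hP).2.2.2⟩
  set Dn := ∑ P ∈ V, d P with hDn
  have hDn0 : 0 ≤ Dn := sum_nonneg fun P _ => hd0 P
  have hDnle : Dn ≤ 6 / Y ^ (1 / 3 : ℝ) := by
    rw [hDn, hd, ← sum_filter]
    exact sum_inv_absNorm_nonprime_le hY _ fun P hP => by
      rw [mem_filter] at hP
      exact ⟨(hV P hP.1).1, (hV P hP.1).2.1, hP.2, (hV P hP.1).2.2.1⟩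
  set En := ∑ q ∈ V ×ˢ V, e q.1 q.2 with hEn
  have hEnle : En ≤ 18 / Y := by
    rw [hEn, he, ← sum_filter]
    exact sum_inv_absNorm_pair_eq_le (by linarith) _ fun p hp => by
      rw [mem_filter, mem_product] at hp
      exact ⟨(hV _ hp.1.1).1, (hV _ hp.1.1).2.1, (hV _ hp.1.2).1, (hV _ hp.1.2).2.1, hp.2,
        (hV _ hp.1.1).2.2.1⟩
  -- domination of the defect indicator
  set G : Ideal (𝓞 K) × Ideal (𝓞 K) → ℝ := fun p => d p.1 * f p.2 + f p.1 * d p.2 + e p.1 p.2 with hG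
  have hG0 : ∀ p, 0 ≤ G p := fun p => by
    rw [hG]; dsimp only
    exact add_nonneg (add_nonneg (mul_nonneg (hd0 _) (hf0 _)) (mul_nonneg (hf0 _) (hd0 _))) (he0 _ _)
  set D := (V ×ˢ V).filter (fun p => ¬ (Ideal.absNorm p.1).Prime ∨ ¬ (Ideal.absNorm p.2).Prime ∨
        Ideal.absNorm p.1 = Ideal.absNorm p.2) with hD
  have hdom : ∀ p ∈ D, f p.1 * f p.2 ≤ G p := by
    intro p hp
    rw [hD, mem_filter] at hp
    obtain ⟨-, hdef⟩ := hp
    have n1 := mul_nonneg (hd0 p.1) (hf0 p.2)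
    have n2 := mul_nonneg (hf0 p.1) (hd0 p.2)
    have n3 := he0 p.1 p.2
    rw [hG]; dsimp only
    rcases hdef with hc | hc | hc
    · have h' : d p.1 = f p.1 := by rw [hd]; dsimp only; rw [if_pos hc]
      have ht : d p.1 * f p.2 = f p.1 * f p.2 := by rw [h']
      linarith
    · have h' : d p.2 = f p.2 := by rw [hd]; dsimp only; rw [if_pos hc]
      have ht : f p.1 * d p.2 = f p.1 * f p.2 := by rw [h']
      linarith
    · have ht : e p.1 p.2 = f p.1 * f p.2 := by rw [he]; dsimp only; rw [if_pos hc]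
      linarith
  have e1 : ∑ p ∈ V ×ˢ V, d p.1 * f p.2 = Dn * S := by rw [hDn, hS, sum_mul_sum, sum_product]
  have e2 : ∑ p ∈ V ×ˢ V, f p.1 * d p.2 = S * Dn := by rw [hDn, hS, sum_mul_sum, sum_product]
  have hsumG : ∑ p ∈ V ×ˢ V, G p = Dn * S + S * Dn + En := by
    rw [hG]; dsimp only
    rw [sum_add_distrib, sum_add_distrib, e1, e2, ← hEn]
  have hH0 : 0 ≤ 3 * (1 + Real.log x) := by have := Real.log_nonneg hx; positivity
  calc ∑ p ∈ D, f p.1 * f p.2 ≤ ∑ p ∈ D, G p := sum_le_sum hdom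
    _ ≤ ∑ p ∈ V ×ˢ V, G p := sum_le_sum_of_subset_of_nonneg (filter_subset _ _) fun p _ _ => hG0 p
    _ = Dn * S + S * Dn + En := hsumG
    _ ≤ 6 / Y ^ (1 / 3 : ℝ) * (3 * (1 + Real.log x)) + (3 * (1 + Real.log x)) * (6 / Y ^ (1 / 3 : ℝ)) +
          18 / Y := by gcongr
    _ = _ := by ring

/-- Triple sums over `V × V × V` of a product of one-variable weights factor. [folklore] -/
theorem sum_triple_mul_eq (V : Finset (Ideal (𝓞 K))) (a b c : Ideal (𝓞 K) → ℝ) :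
    ∑ p ∈ V ×ˢ (V ×ˢ V), a p.1 * b p.2.1 * c p.2.2 =
      (∑ P ∈ V, a P) * (∑ P ∈ V, b P) * (∑ P ∈ V, c P) := by
  rw [sum_product, mul_assoc, sum_mul]
  refine sum_congr rfl fun x _ => ?_
  rw [sum_product, sum_mul_sum, mul_sum]
  refine sum_congr rfl fun y _ => ?_
  rw [mul_sum]
  exact sum_congr rfl fun _ _ => by ring

/-- Triple sums over `V × V × V` of `u(P_1, P_2) c(P_3)` factor. [folklore] -/
theorem sum_triple_pair12_eq (V : Finset (Ideal (𝓞 K))) (u : Ideal (𝓞 K) → Ideal (𝓞 K) → ℝ)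
    (c : Ideal (𝓞 K) → ℝ) :
    ∑ p ∈ V ×ˢ (V ×ˢ V), u p.1 p.2.1 * c p.2.2 =
      (∑ q ∈ V ×ˢ V, u q.1 q.2) * (∑ P ∈ V, c P) := by
  rw [sum_product, sum_product, sum_mul]
  refine sum_congr rfl fun x _ => ?_
  rw [sum_product, sum_mul]
  exact sum_congr rfl fun y _ => by rw [mul_sum]

/-- Triple sums over `V × V × V` of `u(P_1, P_3) b(P_2)` factor. [folklore] -/
theorem sum_triple_pair13_eq (V : Finset (Ideal (𝓞 K))) (u : Ideal (𝓞 K) → Ideal (𝓞 K) → ℝ)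
    (b : Ideal (𝓞 K) → ℝ) :
    ∑ p ∈ V ×ˢ (V ×ˢ V), u p.1 p.2.2 * b p.2.1 =
      (∑ q ∈ V ×ˢ V, u q.1 q.2) * (∑ P ∈ V, b P) := by
  rw [sum_product, sum_product, sum_mul]
  refine sum_congr rfl fun x _ => ?_
  rw [sum_product, sum_comm, sum_mul]
  exact sum_congr rfl fun y _ => by rw [mul_sum]

/-- Triple sums over `V × V × V` of `a(P_1) u(P_2, P_3)` factor. [folklore] -/
theorem sum_triple_pair23_eq (V : Finset (Ideal (𝓞 K))) (u : Ideal (𝓞 K) → Ideal (𝓞 K) → ℝ)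
    (a : Ideal (𝓞 K) → ℝ) :
    ∑ p ∈ V ×ˢ (V ×ˢ V), a p.1 * u p.2.1 p.2.2 =
      (∑ P ∈ V, a P) * (∑ q ∈ V ×ˢ V, u q.1 q.2) := by
  rw [sum_product, sum_mul]
  refine sum_congr rfl fun x _ => ?_
  rw [mul_sum, sum_product]

/-- **Defective triples are negligible**: over triples `(P_1, P_2, P_3)` of nonzero prime ideals with
norms in `(Y, x]` such that some `N(P_i)` is not prime or two of the norms coincide,
`∑ N(P_1)^{-1}N(P_2)^{-1}N(P_3)^{-1} ≤ 3·(6Y^{-1/3})·H² + 3·(18/Y)·H`, `H = 3(1 + log x)` (p. 42, as for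
pairs: each defect is dominated by the corresponding one- or two-variable defect sum times full sums).
[cite: HeathBrownActa2001, §7 p. 42] -/
theorem sum_triple_defect_le {Y x : ℝ} (hY : 8 ≤ Y) (hx : 1 ≤ x) (V : Finset (Ideal (𝓞 K)))
    (hV : ∀ P ∈ V, P.IsPrime ∧ P ≠ ⊥ ∧ Y < (Ideal.absNorm P : ℝ) ∧ (Ideal.absNorm P : ℝ) ≤ x) :
    ∑ p ∈ (V ×ˢ (V ×ˢ V)).filter (fun p =>
        ¬ (Ideal.absNorm p.1).Prime ∨ ¬ (Ideal.absNorm p.2.1).Prime ∨ ¬ (Ideal.absNorm p.2.2).Prime ∨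
        Ideal.absNorm p.1 = Ideal.absNorm p.2.1 ∨ Ideal.absNorm p.1 = Ideal.absNorm p.2.2 ∨
        Ideal.absNorm p.2.1 = Ideal.absNorm p.2.2),
        ((Ideal.absNorm p.1 : ℕ) : ℝ)⁻¹ * ((Ideal.absNorm p.2.1 : ℕ) : ℝ)⁻¹ *
          ((Ideal.absNorm p.2.2 : ℕ) : ℝ)⁻¹ ≤
      3 * (6 / Y ^ (1 / 3 : ℝ)) * (3 * (1 + Real.log x)) ^ 2 + 3 * (18 / Y) * (3 * (1 + Real.log x)) := by
  classical
  set f : Ideal (𝓞 K) → ℝ := fun P => ((Ideal.absNorm P : ℕ) : ℝ)⁻¹ with hf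
  have hf0 : ∀ P, 0 ≤ f P := fun P => by rw [hf]; positivity
  -- indicators of the two kinds of defect
  set d : Ideal (𝓞 K) → ℝ := fun P => if ¬ (Ideal.absNorm P).Prime then f P else 0 with hd
  set e : Ideal (𝓞 K) → Ideal (𝓞 K) → ℝ :=
    fun P P' => if Ideal.absNorm P = Ideal.absNorm P' then f P * f P' else 0 with he
  have hd0 : ∀ P, 0 ≤ d P := fun P => by
    rw [hd]; dsimp only; split_ifs <;> first | exact le_rfl | exact hf0 P
  have he0 : ∀ P P', 0 ≤ e P P' := fun P P' => by
    rw [he]; dsimp only; split_ifs <;> first | exact le_rfl | exact mul_nonneg (hf0 P) (hf0 P')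
  -- the basic sums
  set S := ∑ P ∈ V, f P with hS
  set H := 3 * (1 + Real.log x) with hH
  have hS0 : 0 ≤ S := sum_nonneg fun P _ => hf0 P
  have hSH : S ≤ H := sum_inv_absNorm_le hx V fun P hP => ⟨(hV P hP).1, (hV P hP).2.1, (hV P hP).2.2.2⟩
  have hH0 : 0 ≤ H := hS0.trans hSH
  set Dn := ∑ P ∈ V, d P with hDn
  have hDn0 : 0 ≤ Dn := sum_nonneg fun P _ => hd0 P
  have hDnle : Dn ≤ 6 / Y ^ (1 / 3 : ℝ) := by
    rw [hDn, hd, ← sum_filter]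
    exact sum_inv_absNorm_nonprime_le hY _ fun P hP => by
      rw [mem_filter] at hP
      exact ⟨(hV P hP.1).1, (hV P hP.1).2.1, hP.2, (hV P hP.1).2.2.1⟩
  set En := ∑ q ∈ V ×ˢ V, e q.1 q.2 with hEn
  have hEn0 : 0 ≤ En := sum_nonneg fun q _ => he0 _ _
  have hEnle : En ≤ 18 / Y := by
    rw [hEn, he, ← sum_filter]
    exact sum_inv_absNorm_pair_eq_le (by linarith) _ fun p hp => by
      rw [mem_filter, mem_product] at hp
      exact ⟨(hV _ hp.1.1).1, (hV _ hp.1.1).2.1, (hV _ hp.1.2).1, (hV _ hp.1.2).2.1, hp.2,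
        (hV _ hp.1.1).2.2.1⟩
  -- domination of the defect indicator
  set G : Ideal (𝓞 K) × Ideal (𝓞 K) × Ideal (𝓞 K) → ℝ := fun p =>
    d p.1 * f p.2.1 * f p.2.2 + f p.1 * d p.2.1 * f p.2.2 + f p.1 * f p.2.1 * d p.2.2 +
      e p.1 p.2.1 * f p.2.2 + e p.1 p.2.2 * f p.2.1 + f p.1 * e p.2.1 p.2.2 with hG
  set D := (V ×ˢ (V ×ˢ V)).filter (fun p =>
        ¬ (Ideal.absNorm p.1).Prime ∨ ¬ (Ideal.absNorm p.2.1).Prime ∨ ¬ (Ideal.absNorm p.2.2).Prime ∨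
        Ideal.absNorm p.1 = Ideal.absNorm p.2.1 ∨ Ideal.absNorm p.1 = Ideal.absNorm p.2.2 ∨
        Ideal.absNorm p.2.1 = Ideal.absNorm p.2.2) with hD
  have hterms : ∀ p : Ideal (𝓞 K) × Ideal (𝓞 K) × Ideal (𝓞 K),
      0 ≤ d p.1 * f p.2.1 * f p.2.2 ∧ 0 ≤ f p.1 * d p.2.1 * f p.2.2 ∧ 0 ≤ f p.1 * f p.2.1 * d p.2.2 ∧
      0 ≤ e p.1 p.2.1 * f p.2.2 ∧ 0 ≤ e p.1 p.2.2 * f p.2.1 ∧ 0 ≤ f p.1 * e p.2.1 p.2.2 := fun p =>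
    ⟨mul_nonneg (mul_nonneg (hd0 _) (hf0 _)) (hf0 _), mul_nonneg (mul_nonneg (hf0 _) (hd0 _)) (hf0 _),
      mul_nonneg (mul_nonneg (hf0 _) (hf0 _)) (hd0 _), mul_nonneg (he0 _ _) (hf0 _),
      mul_nonneg (he0 _ _) (hf0 _), mul_nonneg (hf0 _) (he0 _ _)⟩
  have hG0 : ∀ p, 0 ≤ G p := fun p => by
    obtain ⟨n1, n2, n3, n4, n5, n6⟩ := hterms p
    rw [hG]; dsimp only
    linarith
  have hdom : ∀ p ∈ D, f p.1 * f p.2.1 * f p.2.2 ≤ G p := by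
    intro p hp
    rw [hD, mem_filter] at hp
    obtain ⟨-, hdef⟩ := hp
    obtain ⟨n1, n2, n3, n4, n5, n6⟩ := hterms p
    rw [hG]; dsimp only
    rcases hdef with hc | hc | hc | hc | hc | hc
    · have h' : d p.1 = f p.1 := by rw [hd]; dsimp only; rw [if_pos hc]
      have ht : d p.1 * f p.2.1 * f p.2.2 = f p.1 * f p.2.1 * f p.2.2 := by rw [h']
      linarith
    · have h' : d p.2.1 = f p.2.1 := by rw [hd]; dsimp only; rw [if_pos hc]
      have ht : f p.1 * d p.2.1 * f p.2.2 = f p.1 * f p.2.1 * f p.2.2 := by rw [h']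
      linarith
    · have h' : d p.2.2 = f p.2.2 := by rw [hd]; dsimp only; rw [if_pos hc]
      have ht : f p.1 * f p.2.1 * d p.2.2 = f p.1 * f p.2.1 * f p.2.2 := by rw [h']
      linarith
    · have h' : e p.1 p.2.1 = f p.1 * f p.2.1 := by rw [he]; dsimp only; rw [if_pos hc]
      have ht : e p.1 p.2.1 * f p.2.2 = f p.1 * f p.2.1 * f p.2.2 := by rw [h']
      linarith
    · have h' : e p.1 p.2.2 = f p.1 * f p.2.2 := by rw [he]; dsimp only; rw [if_pos hc]
      have ht : e p.1 p.2.2 * f p.2.1 = f p.1 * f p.2.1 * f p.2.2 := by rw [h']; ring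
      linarith
    · have h' : e p.2.1 p.2.2 = f p.2.1 * f p.2.2 := by rw [he]; dsimp only; rw [if_pos hc]
      have ht : f p.1 * e p.2.1 p.2.2 = f p.1 * f p.2.1 * f p.2.2 := by rw [h']; ring
      linarith
  -- evaluate `∑ G`
  have hsumG : ∑ p ∈ V ×ˢ (V ×ˢ V), G p =
      Dn * S * S + S * Dn * S + S * S * Dn + En * S + En * S + S * En := by
    rw [hG]; dsimp only
    rw [sum_add_distrib, sum_add_distrib, sum_add_distrib, sum_add_distrib, sum_add_distrib,
      sum_triple_mul_eq, sum_triple_mul_eq, sum_triple_mul_eq, sum_triple_pair12_eq V e f,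
      sum_triple_pair13_eq V e f, sum_triple_pair23_eq V e f]
  calc ∑ p ∈ D, f p.1 * f p.2.1 * f p.2.2 ≤ ∑ p ∈ D, G p := sum_le_sum hdom
    _ ≤ ∑ p ∈ V ×ˢ (V ×ˢ V), G p :=
        sum_le_sum_of_subset_of_nonneg (filter_subset _ _) fun p _ _ => hG0 p
    _ = Dn * S * S + S * Dn * S + S * S * Dn + En * S + En * S + S * En := hsumG
    _ = 3 * Dn * S ^ 2 + 3 * En * S := by ring
    _ ≤ 3 * (6 / Y ^ (1 / 3 : ℝ)) * H ^ 2 + 3 * (18 / Y) * H := by gcongr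

end Literature.NumberTheory.Sieve.CubicSieve

end
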